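import Literature.NumberTheory.EllipticCurves.RankinSymmSquareGL2Fields
import Literature.NumberTheory.EllipticCurves.NewformPeterssonSizeSiegelReductionProofs
import Literature.NumberTheory.EllipticCurves.LFunctionCoefficientBound
import HarnessLib

/-!
# Twist-equivalent elliptic newforms have comparable `L_f(1)` (the case "`F_i ≃ F_j`" of the
Hoffstein–Lockhart scheme)

Topic `NumberTheory/EllipticCurves`; namespace `Literature.NumberTheory.EllipticCurves.ModularForms`.
In Siegel's argument for the symmetric-square family (`LFunctions/SiegelTheoremPairAbstract`, field
`equiv_case`; Hoffstein–Lockhart 1994, proof of Thm. 0.1, the case where `f_i` is a quadratic twist of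
the exceptional form) one needs, ON the equivalence relation off which the pair functions
`L(s, Sym² f_i × Sym² f_j)` are holomorphic, a direct comparison
`L_{f_i}(1) ≥ D(δ)(N_iN_j)^{−δ} L_{f_j}(1)`. For the newforms of elliptic curves over `ℚ` the natural
`GL₂`-side relation is

* `TwistEquiv i j : ∀ p prime, p ∤ N_iN_j → |a_p(f_i)| = |a_p(f_j)|`

(model: `f_j = f_i ⊗ χ`, `χ` quadratic; conversely, if `Sym² π_i ≃ Sym² π_j` then `a_p(f_i)² = a_p(f_j)²`
at all good primes, so OFF `TwistEquiv` the Rankin–Selberg convolution of the Gelbart–Jacquet lifts of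
two non-CM forms is entire). We PROVE the comparison for it, entirely on the `GL₂` side:

* `sqCoeffAt f p`, `sqLocalFactor f p s = Σ_e |a_{p^e}|² p^{−e(s+1)}` — the local factor of
  `L(|a|², s + 1)` at `p` as a Dirichlet series supported on the powers of `p`; for the newform of an
  elliptic curve it converges absolutely for `Re s > 0` (Hasse: `|a_{p^e}|² ≤ (e+1)² p^e`,
  `abs_LFunction_prime_pow_le`), is holomorphic there (`differentiableOn_sqLocalFactor`), real `≥ 1`
  at real points and `≤ 1 + 30/p` at `s = 1` (`sqLocalFactor_one_le`);
* `tsum_normSq_mul_prod_eq` — for two newforms with `|a_p|` equal at the primes `p ∤ N₁N₂` and real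
  `w > 2`: `(Σ|a_n(f₁)|²n^{−w}) · ∏_{p∣N₁N₂} E_p(f₂, w) = (Σ|a_n(f₂)|²n^{−w}) · ∏_{p∣N₁N₂} E_p(f₁, w)`
  (Euler products as limits over `primesBelow n`, `EulerProduct.eulerProduct`; at a good prime the local
  factor is a rational function of `|a_p|²`, `IsNewform0.tsum_normSq_cuspCoeff_prime_pow_of_not_dvd`);
* `symmSqL_mul_prod_sqLocalFactor_eq` — the identity
  `L_{f₁}(s) ∏_{p∣N₁N₂} E_p(f₂, s) = L_{f₂}(s) ∏_{p∣N₁N₂} E_p(f₁, s)` on the Siegel ball (identity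
  theorem from the real interval `(1, 3)`, `eqOn_of_differentiableOn_of_eq_on_Ioo`), in particular at
  `s = 1`;
* `exists_prod_primeFactors_one_add_div_le` — `∏_{p∣M}(1 + C/p) ≤ K(δ) M^δ`;
* **`twistEquiv_equiv_case`** — `∀ δ > 0 ∃ D > 0 ∀ i j, TwistEquiv i j →
  D (N_iN_j)^{−δ} Re L_{f_j}(1) ≤ Re L_{f_i}(1)`, the field `equiv_case` for `Equiv = TwistEquiv`.

## References

* J. Hoffstein, P. Lockhart, *Coefficients of Maass forms and the Siegel zero*, Ann. of Math. 140
  (1994), proof of Thm. 0.1 (the twist-equivalent case). [cite: HoffsteinLockhart1994, Thm. 0.1 (proof)]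
* D. Bump, *Automorphic forms and representations* (1997), §3.9 (the local factors of
  `L(s, π × π̃)`). [cite: Bump1997, §3.9]
* J. H. Silverman, *The arithmetic of elliptic curves*, Thm. V.1.1 (Hasse). [cite: SilvermanAEC2009, Thm. V.1.1]

## Mathlib / tree search

Tree: `IsNewform0.hasProd_tsum_normSq_cuspCoeff_prime_pow`,
`IsNewform0.tsum_normSq_cuspCoeff_prime_pow_of_not_dvd`, `summable_normSq_cuspCoeff_div_rpow`,
`exists_finset_primes_mem_iff_dvd`, `prod_finset_primes_eq_prod_primeFactors`,
`IsNewformOf.norm_cuspCoeff_sq_eq` (`NewformPeterssonSizeSymmSquareProofs`); `abs_LFunction_prime_pow_le`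
(`LFunctionCoefficientBound`); `symmSqL`, `symmSqL_eq_of_one_lt_re`, `differentiableOn_symmSqL`,
`exists_siegel_radius`, `symmSqL_one_re_pos`, `eqOn_of_differentiableOn_of_eq_on_Ioo`
(`RankinSymmSquareGL2Fields`); `LSeries_ofReal_apply_ofReal` (`Gamma0RankinSelbergMoebiusAssembly`);
`EllipticNewformIndex` (`NewformPeterssonSizeSiegelReductionProofs`). Mathlib: `LSeries_differentiableOn`,
`LSeries.abscissaOfAbsConv_le_of_forall_lt_LSeriesSummable`, `Function.Injective.tsum_eq`,
`EulerProduct.eulerProduct`, `summable_pow_mul_geometric_of_norm_lt_one`, `Real.add_one_le_exp`.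
-/

noncomputable section

open scoped Real Topology
open Set Filter Metric Complex CongruenceSubgroup LSeries

namespace Literature.NumberTheory.EllipticCurves.ModularForms

/-! ### Elementary inequalities -/

section Elementary

/-- `(e + 1)² ≤ 5 (3/2)^e` for all `e`. [folklore] -/
theorem sq_succ_le_five_mul_pow (e : ℕ) : ((e : ℝ) + 1) ^ 2 ≤ 5 * (3 / 2 : ℝ) ^ e := by
  rcases lt_or_ge e 4 with h | h
  · interval_cases e <;> norm_num
  · induction e, h using Nat.le_induction with
    | base => norm_num
    | succ n hn ih =>
      have hn' : (4 : ℝ) ≤ n := by exact_mod_cast hn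
      calc ((((n + 1 : ℕ) : ℝ)) + 1) ^ 2 = ((n : ℝ) + 2) ^ 2 := by push_cast; ring
        _ ≤ 3 / 2 * ((n : ℝ) + 1) ^ 2 := by nlinarith
        _ ≤ 3 / 2 * (5 * (3 / 2 : ℝ) ^ n) := by gcongr
        _ = 5 * (3 / 2 : ℝ) ^ (n + 1) := by ring

/-- **`∏_{p ∣ M} (1 + C/p) ≤ K(δ) M^δ`** for every `C ≥ 0`, `δ > 0` and all `M ≥ 1`: the primes
`p ≤ y = ⌈C/(δ log 2)⌉ + 1` contribute at most `(1 + C)^{y+1}`, each larger prime factor at most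
`1 + C/y ≤ 2^δ`, and `2^{ω(M)} ≤ M`. [folklore] -/
theorem exists_prod_primeFactors_one_add_div_le {C : ℝ} (hC : 0 ≤ C) {δ : ℝ} (hδ : 0 < δ) :
    ∃ K : ℝ, 0 < K ∧ ∀ M : ℕ, M ≠ 0 →
      ∏ p ∈ M.primeFactors, (1 + C / p) ≤ K * (M : ℝ) ^ δ := by
  have hlog2 : 0 < Real.log 2 := Real.log_pos one_lt_two
  set y : ℕ := ⌈C / (δ * Real.log 2)⌉₊ + 1 with hy
  have hy0 : (0 : ℝ) < y := by rw [hy]; positivity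
  have hyC : C / y ≤ δ * Real.log 2 := by
    rw [div_le_iff₀ hy0]
    have h1 : C / (δ * Real.log 2) ≤ ⌈C / (δ * Real.log 2)⌉₊ := Nat.le_ceil _
    have h2 : (⌈C / (δ * Real.log 2)⌉₊ : ℝ) ≤ y := by rw [hy]; push_cast; linarith
    rw [div_le_iff₀ (by positivity)] at h1
    nlinarith [h2, mul_pos hδ hlog2]
  -- each large prime factor contributes at most `2^δ`
  have hlarge : ∀ p : ℕ, y < p → 1 + C / p ≤ (2 : ℝ) ^ δ := by
    intro p hp
    have hp0 : (0 : ℝ) < p := by exact_mod_cast (Nat.zero_le y).trans_lt hp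
    have h1 : C / p ≤ C / y := div_le_div_of_nonneg_left hC hy0 (by exact_mod_cast hp.le)
    calc 1 + C / p ≤ C / y + 1 := by linarith
      _ ≤ Real.exp (C / y) := Real.add_one_le_exp _
      _ ≤ Real.exp (Real.log 2 * δ) := Real.exp_le_exp.mpr (by linarith)
      _ = (2 : ℝ) ^ δ := by rw [Real.rpow_def_of_pos two_pos]
  refine ⟨(1 + C) ^ (y + 1), by positivity, fun M hM ↦ ?_⟩
  set A := M.primeFactors.filter (· ≤ y) with hA
  set B := M.primeFactors.filter (fun p ↦ ¬ p ≤ y) with hB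
  have hsplit : ∏ p ∈ M.primeFactors, (1 + C / (p : ℝ)) =
      (∏ p ∈ A, (1 + C / (p : ℝ))) * ∏ p ∈ B, (1 + C / (p : ℝ)) :=
    (Finset.prod_filter_mul_prod_filter_not _ _ _).symm
  have hterm1 : ∀ p ∈ M.primeFactors, (1 : ℝ) ≤ 1 + C / p := fun p _ ↦ by
    have : 0 ≤ C / (p : ℝ) := by positivity
    linarith
  -- small primes
  have hAcard : A.card ≤ y + 1 := by
    calc A.card ≤ (Finset.range (y + 1)).card :=
          Finset.card_le_card fun p hp ↦ by
            rw [hA, Finset.mem_filter] at hp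
            exact Finset.mem_range.mpr (Nat.lt_succ_of_le hp.2)
      _ = y + 1 := Finset.card_range _
  have hAle : ∏ p ∈ A, (1 + C / (p : ℝ)) ≤ (1 + C) ^ (y + 1) := by
    calc ∏ p ∈ A, (1 + C / (p : ℝ)) ≤ ∏ _p ∈ A, (1 + C) := by
          refine Finset.prod_le_prod (fun p hp ↦ ?_) fun p hp ↦ ?_
          · exact zero_le_one.trans (hterm1 p (Finset.mem_filter.mp hp).1)
          · have hpp : (1 : ℝ) ≤ p := by
              exact_mod_cast (Nat.prime_of_mem_primeFactors (Finset.mem_filter.mp hp).1).one_le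
            have : C / (p : ℝ) ≤ C := div_le_self hC hpp
            linarith
      _ = (1 + C) ^ A.card := Finset.prod_const _
      _ ≤ (1 + C) ^ (y + 1) := pow_le_pow_right₀ (by linarith) hAcard
  -- large primes
  have hBcard : (2 : ℝ) ^ B.card ≤ M := by
    have h1 : B.card ≤ M.primeFactors.card := Finset.card_filter_le _ _
    have h2 : 2 ^ M.primeFactors.card ≤ M := by
      calc 2 ^ M.primeFactors.card ≤ ∏ p ∈ M.primeFactors, p :=
            Finset.pow_card_le_prod _ _ _ fun p hp ↦ (Nat.prime_of_mem_primeFactors hp).two_le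
        _ ≤ M := Nat.le_of_dvd (Nat.pos_of_ne_zero hM) (Nat.prod_primeFactors_dvd M)
    calc (2 : ℝ) ^ B.card ≤ (2 : ℝ) ^ M.primeFactors.card := pow_le_pow_right₀ one_le_two h1
      _ ≤ M := by exact_mod_cast h2
  have hBle : ∏ p ∈ B, (1 + C / (p : ℝ)) ≤ (M : ℝ) ^ δ := by
    calc ∏ p ∈ B, (1 + C / (p : ℝ)) ≤ ∏ _p ∈ B, (2 : ℝ) ^ δ := by
          refine Finset.prod_le_prod (fun p hp ↦ ?_) fun p hp ↦ ?_
          · exact zero_le_one.trans (hterm1 p (Finset.mem_filter.mp hp).1)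
          · exact hlarge p (not_le.mp (Finset.mem_filter.mp hp).2)
      _ = ((2 : ℝ) ^ δ) ^ B.card := Finset.prod_const _
      _ = ((2 : ℝ) ^ B.card) ^ δ := by
          rw [← Real.rpow_natCast, ← Real.rpow_natCast, ← Real.rpow_mul zero_le_two,
            ← Real.rpow_mul zero_le_two, mul_comm]
      _ ≤ (M : ℝ) ^ δ := Real.rpow_le_rpow (by positivity) hBcard hδ.le
  have hA0 : 0 ≤ ∏ p ∈ A, (1 + C / (p : ℝ)) :=
    Finset.prod_nonneg fun p hp ↦ zero_le_one.trans (hterm1 p (Finset.mem_filter.mp hp).1)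
  have hB0 : 0 ≤ ∏ p ∈ B, (1 + C / (p : ℝ)) :=
    Finset.prod_nonneg fun p hp ↦ zero_le_one.trans (hterm1 p (Finset.mem_filter.mp hp).1)
  rw [hsplit]
  exact mul_le_mul hAle hBle hB0 (by positivity)

end Elementary

/-! ### The local factor of `L(|a|², s + 1)` at a prime, as a Dirichlet series -/

section LocalFactor

variable {N : ℕ} [NeZero N]

/-- The squared coefficients of `f` supported on the powers of `p`:
`n ↦ |a_n(f)|²` if `n = p^e`, `0` otherwise. [folklore] -/
def sqCoeffAt (f : CuspForm (Gamma0 N) 2) (p : ℕ) : ℕ → ℂ :=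
  (Set.range (p ^ ·)).indicator fun n ↦ ((‖cuspCoeff f n‖ ^ 2 : ℝ) : ℂ)

/-- **The local factor** `E_p(f, s) = Σ_e |a_{p^e}(f)|² p^{−e(s+1)}` of `L(|a|², s + 1)` at `p`
(a Dirichlet series supported on the powers of `p`, shifted by `1` like `symmSqL`). [cite: Bump1997, §3.9] -/
def sqLocalFactor (f : CuspForm (Gamma0 N) 2) (p : ℕ) (s : ℂ) : ℂ :=
  LSeries (sqCoeffAt f p) (s + 1)

omit [NeZero N] in
/-- `sqCoeffAt f p (p^e) = |a_{p^e}|²`. [folklore] -/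
theorem sqCoeffAt_apply_pow (f : CuspForm (Gamma0 N) 2) (p e : ℕ) :
    sqCoeffAt f p (p ^ e) = ((‖cuspCoeff f (p ^ e)‖ ^ 2 : ℝ) : ℂ) :=
  Set.indicator_of_mem (Set.mem_range_self (f := (p ^ ·)) e) _

omit [NeZero N] in
/-- The terms of `L(sqCoeffAt f p, w)` vanish off the powers of `p`. [folklore] -/
theorem support_term_sqCoeffAt_subset (f : CuspForm (Gamma0 N) 2) (p : ℕ) (w : ℂ) :
    Function.support (term (sqCoeffAt f p) w) ⊆ Set.range (p ^ ·) := by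
  intro n hn
  by_contra h
  apply hn
  rcases Nat.eq_zero_or_pos n with rfl | hn0
  · exact term_zero _ _
  · rw [term_of_ne_zero hn0.ne', sqCoeffAt, Set.indicator_of_notMem h, zero_div]

omit [NeZero N] in
/-- **`L(sqCoeffAt f p, w) = Σ_e |a_{p^e}|² (p^e)^{−w}`** (reindexing along `e ↦ p^e`). [folklore] -/
theorem LSeries_sqCoeffAt_eq_tsum (f : CuspForm (Gamma0 N) 2) {p : ℕ} (hp : p.Prime) (w : ℂ) :
    LSeries (sqCoeffAt f p) w =
      ∑' e : ℕ, ((‖cuspCoeff f (p ^ e)‖ ^ 2 : ℝ) : ℂ) / ((p ^ e : ℕ) : ℂ) ^ w := by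
  rw [LSeries, ← (Nat.pow_right_injective hp.two_le).tsum_eq (support_term_sqCoeffAt_subset f p w)]
  refine tsum_congr fun e ↦ ?_
  have hpe : p ^ e ≠ 0 := pow_ne_zero e hp.ne_zero
  rw [term_of_ne_zero hpe, sqCoeffAt_apply_pow]

omit [NeZero N] in
/-- The rpow bookkeeping `|a|²/(p^e)^w = |a|² (p^{−w})^e` (real `w`). [folklore] -/
theorem div_pow_rpow_eq_mul_rpow_neg_pow {p : ℕ} (hp : 0 < p) (c w : ℝ) (e : ℕ) :
    c / ((p ^ e : ℕ) : ℝ) ^ w = c * ((p : ℝ) ^ (-w)) ^ e := by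
  have hp0 : (0 : ℝ) ≤ p := by positivity
  have h1 : ((p ^ e : ℕ) : ℝ) ^ w = (p : ℝ) ^ ((e : ℝ) * w) := by
    rw [Nat.cast_pow, ← Real.rpow_natCast, ← Real.rpow_mul hp0]
  have h2 : ((p : ℝ) ^ (-w)) ^ e = (p : ℝ) ^ (-((e : ℝ) * w)) := by
    rw [← Real.rpow_natCast, ← Real.rpow_mul hp0]; ring_nf
  rw [h1, h2, Real.rpow_neg hp0, div_eq_mul_inv]

omit [NeZero N] in
/-- **Real points**: `L(sqCoeffAt f p, x) = Σ_e |a_{p^e}|² (p^{−x})^e` as a real number (real `x`).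
[folklore] -/
theorem LSeries_sqCoeffAt_ofReal (f : CuspForm (Gamma0 N) 2) {p : ℕ} (hp : p.Prime) (x : ℝ) :
    LSeries (sqCoeffAt f p) x =
      ((∑' e : ℕ, ‖cuspCoeff f (p ^ e)‖ ^ 2 * ((p : ℝ) ^ (-x)) ^ e : ℝ) : ℂ) := by
  rw [LSeries_sqCoeffAt_eq_tsum f hp, Complex.ofReal_tsum]
  refine tsum_congr fun e ↦ ?_
  rw [← div_pow_rpow_eq_mul_rpow_neg_pow hp.pos, Complex.ofReal_div,
    Complex.ofReal_cpow (Nat.cast_nonneg _)]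
  norm_cast

/-- **Hasse at prime powers for the newform of an elliptic curve**: `|a_{p^e}(f)|² ≤ (e+1)² p^e`
(`a_n(f) = a_n(W)`, `abs_LFunction_prime_pow_le`). [cite: SilvermanAEC2009, Thm. V.1.1] -/
theorem IsNewformOf.norm_cuspCoeff_prime_pow_sq_le {W : WeierstrassCurve ℚ} [W.IsElliptic]
    {f : CuspForm (Gamma0 N) 2} (hf : IsNewformOf W f) {p : ℕ} (hp : p.Prime) (e : ℕ) :
    ‖cuspCoeff f (p ^ e)‖ ^ 2 ≤ ((e : ℝ) + 1) ^ 2 * (p : ℝ) ^ e := by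
  rw [hf.norm_cuspCoeff_sq_eq (p ^ e)]
  have h := W.abs_LFunction_prime_pow_le hp e
  have hsqrt : Real.sqrt p ^ e ≥ 0 := by positivity
  have h0 : 0 ≤ ((e : ℝ) + 1) * Real.sqrt p ^ e := by positivity
  calc ((W.LFunction (p ^ e) : ℤ) : ℝ) ^ 2 = |((W.LFunction (p ^ e) : ℤ) : ℝ)| ^ 2 := (sq_abs _).symm
    _ ≤ (((e : ℝ) + 1) * Real.sqrt p ^ e) ^ 2 := pow_le_pow_left₀ (abs_nonneg _) h 2
    _ = ((e : ℝ) + 1) ^ 2 * (Real.sqrt p ^ 2) ^ e := by ring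
    _ = ((e : ℝ) + 1) ^ 2 * (p : ℝ) ^ e := by rw [Real.sq_sqrt (Nat.cast_nonneg p)]

/-- Summability of the local series at real `x > 1`: `Σ_e |a_{p^e}|² (p^{−x})^e < ∞`
(terms `≤ (e+1)² (p^{1−x})^e`). [folklore] -/
theorem IsNewformOf.summable_normSq_prime_pow_mul_pow {W : WeierstrassCurve ℚ} [W.IsElliptic]
    {f : CuspForm (Gamma0 N) 2} (hf : IsNewformOf W f) {p : ℕ} (hp : p.Prime) {x : ℝ} (hx : 1 < x) :
    Summable fun e : ℕ ↦ ‖cuspCoeff f (p ^ e)‖ ^ 2 * ((p : ℝ) ^ (-x)) ^ e := by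
  have hp1 : (1 : ℝ) < p := by exact_mod_cast hp.one_lt
  have hp0 : (0 : ℝ) < p := by linarith
  set r : ℝ := (p : ℝ) ^ (1 - x) with hr
  have hr0 : 0 ≤ r := Real.rpow_nonneg hp0.le _
  have hr1 : r < 1 := Real.rpow_lt_one_of_one_lt_of_neg hp1 (by linarith)
  have hrn : ‖r‖ < 1 := by rwa [Real.norm_of_nonneg hr0]
  have hsum1 : Summable fun e : ℕ ↦ (e : ℝ) ^ 2 * r ^ e := summable_pow_mul_geometric_of_norm_lt_one 2 hrn
  have hsum2 : Summable fun e : ℕ ↦ r ^ e := summable_geometric_of_lt_one hr0 hr1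
  have hsum : Summable fun e : ℕ ↦ 2 * ((e : ℝ) ^ 2 * r ^ e) + 2 * r ^ e :=
    (hsum1.mul_left 2).add (hsum2.mul_left 2)
  refine Summable.of_nonneg_of_le (fun e ↦ by positivity) (fun e ↦ ?_) hsum
  have hkey : (p : ℝ) ^ e * ((p : ℝ) ^ (-x)) ^ e = r ^ e := by
    rw [← mul_pow]
    congr 1
    rw [hr, sub_eq_add_neg, Real.rpow_add hp0, Real.rpow_one]
  calc ‖cuspCoeff f (p ^ e)‖ ^ 2 * ((p : ℝ) ^ (-x)) ^ e
      ≤ ((e : ℝ) + 1) ^ 2 * (p : ℝ) ^ e * ((p : ℝ) ^ (-x)) ^ e := by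
        gcongr
        exact hf.norm_cuspCoeff_prime_pow_sq_le hp e
    _ = ((e : ℝ) + 1) ^ 2 * r ^ e := by rw [mul_assoc, hkey]
    _ ≤ (2 * (e : ℝ) ^ 2 + 2) * r ^ e := by
        gcongr
        nlinarith [sq_nonneg ((e : ℝ) - 1)]
    _ = 2 * ((e : ℝ) ^ 2 * r ^ e) + 2 * r ^ e := by ring

/-- **Absolute convergence of `L(sqCoeffAt f p, w)` for `Re w > 1`.** [folklore] -/
theorem IsNewformOf.LSeriesSummable_sqCoeffAt {W : WeierstrassCurve ℚ} [W.IsElliptic]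
    {f : CuspForm (Gamma0 N) 2} (hf : IsNewformOf W f) {p : ℕ} (hp : p.Prime) {x : ℝ} (hx : 1 < x) :
    LSeriesSummable (sqCoeffAt f p) x := by
  rw [LSeriesSummable, ← (Nat.pow_right_injective hp.two_le).summable_iff
    (fun n hn ↦ Function.notMem_support.mp fun h ↦ hn (support_term_sqCoeffAt_subset f p x h))]
  have h := hf.summable_normSq_prime_pow_mul_pow hp hx
  refine (Complex.summable_ofReal.mpr h).congr fun e ↦ ?_
  simp only [Function.comp_apply]
  rw [term_of_ne_zero (pow_ne_zero e hp.ne_zero), sqCoeffAt_apply_pow,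
    ← div_pow_rpow_eq_mul_rpow_neg_pow hp.pos, Complex.ofReal_div, Complex.ofReal_cpow (Nat.cast_nonneg _)]
  norm_cast

/-- The abscissa of absolute convergence of `sqCoeffAt f p` is at most `1`. [folklore] -/
theorem IsNewformOf.abscissaOfAbsConv_sqCoeffAt_le {W : WeierstrassCurve ℚ} [W.IsElliptic]
    {f : CuspForm (Gamma0 N) 2} (hf : IsNewformOf W f) {p : ℕ} (hp : p.Prime) :
    abscissaOfAbsConv (sqCoeffAt f p) ≤ (1 : ℝ) :=
  abscissaOfAbsConv_le_of_forall_lt_LSeriesSummable fun _ hy ↦ hf.LSeriesSummable_sqCoeffAt hp hy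

/-- **`E_p(f, ·)` is holomorphic on `Re s > 0`** for the newform of an elliptic curve. [folklore] -/
theorem IsNewformOf.differentiableOn_sqLocalFactor {W : WeierstrassCurve ℚ} [W.IsElliptic]
    {f : CuspForm (Gamma0 N) 2} (hf : IsNewformOf W f) {p : ℕ} (hp : p.Prime) :
    DifferentiableOn ℂ (sqLocalFactor f p) {s : ℂ | 0 < s.re} := by
  refine (LSeries_differentiableOn (sqCoeffAt f p)).comp (differentiable_id.add_const 1).differentiableOn
    fun s hs ↦ ?_
  simp only [mem_setOf_eq] at hs ⊢
  have h1 : (1 : ℝ) < (s + 1).re := by simp only [add_re, one_re]; linarith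
  exact (hf.abscissaOfAbsConv_sqCoeffAt_le hp).trans_lt (EReal.coe_lt_coe_iff.mpr h1)

/-- **Real values**: for real `σ > 0`, `E_p(f, σ) = Σ_e |a_{p^e}|² (p^{−(σ+1)})^e`, a real number `≥ 1`
(the term `e = 0` is `|a_1|² = 1`). [folklore] -/
theorem IsNewformOf.sqLocalFactor_ofReal {W : WeierstrassCurve ℚ} [W.IsElliptic]
    {f : CuspForm (Gamma0 N) 2} (hf : IsNewformOf W f) {p : ℕ} (hp : p.Prime) {σ : ℝ} (hσ : 0 < σ) :
    sqLocalFactor f p σ =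
        ((∑' e : ℕ, ‖cuspCoeff f (p ^ e)‖ ^ 2 * ((p : ℝ) ^ (-(σ + 1))) ^ e : ℝ) : ℂ) ∧
      1 ≤ ∑' e : ℕ, ‖cuspCoeff f (p ^ e)‖ ^ 2 * ((p : ℝ) ^ (-(σ + 1))) ^ e := by
  constructor
  · rw [sqLocalFactor, show (σ : ℂ) + 1 = ((σ + 1 : ℝ) : ℂ) by push_cast; ring]
    exact LSeries_sqCoeffAt_ofReal f hp (σ + 1)
  · have hs := hf.summable_normSq_prime_pow_mul_pow hp (x := σ + 1) (by linarith)
    have h := hs.le_tsum 0 fun e _ ↦ by positivity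
    simpa [show cuspCoeff f 1 = 1 from hf.1.2.2] using h

/-- **The local factor at `s = 1` is at most `1 + 30/p`**:
`Σ_{e≥1} |a_{p^e}|² p^{−2e} ≤ Σ_{e≥1} (e+1)² p^{−e} ≤ 5 Σ_{e≥1} (3/(2p))^e = 15/(2p − 3) ≤ 30/p`.
[cite: SilvermanAEC2009, Thm. V.1.1] -/
theorem IsNewformOf.sqLocalFactor_one_le {W : WeierstrassCurve ℚ} [W.IsElliptic]
    {f : CuspForm (Gamma0 N) 2} (hf : IsNewformOf W f) {p : ℕ} (hp : p.Prime) :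
    ∑' e : ℕ, ‖cuspCoeff f (p ^ e)‖ ^ 2 * ((p : ℝ) ^ (-(1 + 1 : ℝ))) ^ e ≤ 1 + 30 / p := by
  have hp2 : (2 : ℝ) ≤ p := by exact_mod_cast hp.two_le
  have hp0 : (0 : ℝ) < p := by linarith
  have hs := hf.summable_normSq_prime_pow_mul_pow hp (x := 1 + 1) (by norm_num)
  -- the weight `p^{-2}` and the ratio `q = 3/(2p) ≤ 3/4`
  have hw : (p : ℝ) ^ (-(1 + 1 : ℝ)) = (p : ℝ)⁻¹ ^ 2 := by
    rw [Real.rpow_neg hp0.le, show (1 + 1 : ℝ) = (2 : ℕ) by norm_num, Real.rpow_natCast, inv_pow]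
  set q : ℝ := 3 / (2 * p) with hq
  have hq0 : 0 ≤ q := by positivity
  have hq1 : q < 1 := by rw [hq, div_lt_one (by positivity)]; linarith
  -- termwise bound for `e ≥ 1`: `|a_{p^e}|² p^{-2e} ≤ 5 q^e`
  have hterm : ∀ e : ℕ, ‖cuspCoeff f (p ^ (e + 1))‖ ^ 2 * ((p : ℝ) ^ (-(1 + 1 : ℝ))) ^ (e + 1) ≤
      5 * q ^ (e + 1) := by
    intro e
    have h1 := hf.norm_cuspCoeff_prime_pow_sq_le hp (e + 1)
    have h2 := sq_succ_le_five_mul_pow (e + 1)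
    rw [hw]
    have hpinv : ((p : ℝ)⁻¹ ^ 2) ^ (e + 1) = ((p : ℝ) ^ (e + 1))⁻¹ * ((p : ℝ) ^ (e + 1))⁻¹ := by
      rw [← pow_mul, inv_pow, ← mul_inv, ← pow_add]
      congr 2; ring
    have hqpow : q ^ (e + 1) = (3 / 2 : ℝ) ^ (e + 1) * ((p : ℝ) ^ (e + 1))⁻¹ := by
      rw [hq, div_pow, div_pow, mul_pow, ← div_div, div_eq_mul_inv]
    rw [hpinv, hqpow]
    have hpe : 0 < ((p : ℝ) ^ (e + 1))⁻¹ := by positivity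
    calc ‖cuspCoeff f (p ^ (e + 1))‖ ^ 2 * (((p : ℝ) ^ (e + 1))⁻¹ * ((p : ℝ) ^ (e + 1))⁻¹)
        ≤ (((e + 1 : ℕ) : ℝ) + 1) ^ 2 * (p : ℝ) ^ (e + 1) * (((p : ℝ) ^ (e + 1))⁻¹ * ((p : ℝ) ^ (e + 1))⁻¹) := by
          gcongr
      _ = (((e + 1 : ℕ) : ℝ) + 1) ^ 2 * ((p : ℝ) ^ (e + 1))⁻¹ := by
          field_simp
      _ ≤ 5 * (3 / 2 : ℝ) ^ (e + 1) * ((p : ℝ) ^ (e + 1))⁻¹ := by gcongr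
      _ = 5 * ((3 / 2 : ℝ) ^ (e + 1) * ((p : ℝ) ^ (e + 1))⁻¹) := by ring
  -- split off `e = 0` and sum the geometric majorant
  have hgeom : HasSum (fun e : ℕ ↦ 5 * q ^ (e + 1)) (5 * (q / (1 - q))) := by
    have h := (hasSum_geometric_of_lt_one hq0 hq1).mul_left (5 * q)
    have e1 : (fun e : ℕ ↦ 5 * q ^ (e + 1)) = fun i ↦ 5 * q * q ^ i := by funext i; ring
    have e2 : 5 * (q / (1 - q)) = 5 * q * (1 - q)⁻¹ := by rw [div_eq_mul_inv, mul_assoc]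
    rw [e1, e2]; exact h
  rw [hs.tsum_eq_zero_add]
  have h0 : ‖cuspCoeff f (p ^ 0)‖ ^ 2 * ((p : ℝ) ^ (-(1 + 1 : ℝ))) ^ 0 = 1 := by
    simp [show cuspCoeff f 1 = 1 from hf.1.2.2]
  rw [h0]
  have htail : ∑' e : ℕ, ‖cuspCoeff f (p ^ (e + 1))‖ ^ 2 * ((p : ℝ) ^ (-(1 + 1 : ℝ))) ^ (e + 1) ≤
      5 * (q / (1 - q)) :=
    hasSum_le hterm ((summable_nat_add_iff 1).mpr hs).hasSum hgeom
  have hfin : 5 * (q / (1 - q)) ≤ 30 / p := by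
    have h1q : 0 < 1 - q := by linarith
    rw [show 5 * (q / (1 - q)) = (5 * q) / (1 - q) by ring, div_le_div_iff₀ h1q hp0, hq]
    have e1 : 5 * (3 / (2 * (p : ℝ))) * p = 15 / 2 := by field_simp; ring
    have e2 : 30 * (1 - 3 / (2 * (p : ℝ))) = 30 - 45 / p := by field_simp; ring
    rw [e1, e2]
    have h45 : 45 / (p : ℝ) ≤ 45 / 2 := div_le_div_of_nonneg_left (by norm_num) two_pos hp2
    linarith
  linarith

end LocalFactor

/-! ### Two newforms with the same `|a_p|` at the good primes -/

section Pair

variable {N₁ N₂ : ℕ} [NeZero N₁] [NeZero N₂]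
variable {f₁ : CuspForm (Gamma0 N₁) 2} {f₂ : CuspForm (Gamma0 N₂) 2}

/-- The local factor of `Σ |a_n(f)|² n^{−w}` at `p`, real form: `E_p(f, w) = Σ_e |a_{p^e}|² (p^e)^{−w}`
(the factors of `IsNewform0.hasProd_tsum_normSq_cuspCoeff_prime_pow`). [cite: Bump1997, §3.9] -/
def locSq {N : ℕ} (f : CuspForm (Gamma0 N) 2) (w : ℝ) (p : ℕ) : ℝ :=
  ∑' e : ℕ, ‖cuspCoeff f (p ^ e)‖ ^ 2 / ((p ^ e : ℕ) : ℝ) ^ w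

omit [NeZero N₁] in
/-- `E_p(f, w) = Σ_e |a_{p^e}|² (p^{−w})^e`. [folklore] -/
theorem locSq_eq_tsum_mul_pow (f : CuspForm (Gamma0 N₁) 2) (w : ℝ) {p : ℕ} (hp : 0 < p) :
    locSq f w p = ∑' e : ℕ, ‖cuspCoeff f (p ^ e)‖ ^ 2 * ((p : ℝ) ^ (-w)) ^ e :=
  tsum_congr fun e ↦ div_pow_rpow_eq_mul_rpow_neg_pow hp _ w e

/-- At a good prime, `E_p(f, w)` in closed form: a rational function of `|a_p|²` and `p`
(`IsNewform0.tsum_normSq_cuspCoeff_prime_pow_of_not_dvd`; real `w > 2`). [cite: Bump1997, §3.9] -/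
theorem IsNewform0.locSq_eq_of_not_dvd (hf₁ : IsNewform0 f₁) {w : ℝ} (hw : 2 < w) {p : ℕ} (hp : p.Prime)
    (hpN : ¬ p ∣ N₁) :
    locSq f₁ w p = (1 + p * (p : ℝ) ^ (-w)) /
      ((1 - p * (p : ℝ) ^ (-w)) * (1 - (‖cuspCoeff f₁ p‖ ^ 2 - 2 * p) * (p : ℝ) ^ (-w) +
        (p : ℝ) ^ 2 * ((p : ℝ) ^ (-w)) ^ 2)) := by
  have hx0 : 0 ≤ (p : ℝ) ^ (-w) := Real.rpow_nonneg (Nat.cast_nonneg _) _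
  have hsum : Summable fun e : ℕ ↦ ‖cuspCoeff f₁ (p ^ e)‖ ^ 2 * ((p : ℝ) ^ (-w)) ^ e := by
    have hg := (summable_normSq_cuspCoeff_div_rpow f₁ hw).comp_injective (Nat.pow_right_injective hp.two_le)
    refine hg.congr fun e ↦ ?_
    simp only [Function.comp_apply]
    exact div_pow_rpow_eq_mul_rpow_neg_pow hp.pos _ w e
  rw [locSq_eq_tsum_mul_pow f₁ w hp.pos, hf₁.tsum_normSq_cuspCoeff_prime_pow_of_not_dvd hp hpN hx0 hsum]

/-- **The Euler-product identity for real `w > 2`**: if `|a_p(f₁)| = |a_p(f₂)|` for all primes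
`p ∤ N₁N₂`, then
`(Σ|a_n(f₁)|² n^{−w}) ∏_{p∣N₁N₂} E_p(f₂, w) = (Σ|a_n(f₂)|² n^{−w}) ∏_{p∣N₁N₂} E_p(f₁, w)`:
the Euler products of the two series agree at every prime `p ∤ N₁N₂` (the good local factor is a
rational function of `|a_p|²` and `p`). [cite: Bump1997, §3.9] -/
theorem tsum_normSq_mul_prod_eq (hf₁ : IsNewform0 f₁) (hf₂ : IsNewform0 f₂)
    (h : ∀ p : ℕ, p.Prime → ¬ p ∣ N₁ * N₂ → ‖cuspCoeff f₁ p‖ = ‖cuspCoeff f₂ p‖)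
    {w : ℝ} (hw : 2 < w) :
    (∑' n : ℕ, ‖cuspCoeff f₁ n‖ ^ 2 / (n : ℝ) ^ w) * ∏ p ∈ (N₁ * N₂).primeFactors, locSq f₂ w p =
      (∑' n : ℕ, ‖cuspCoeff f₂ n‖ ^ 2 / (n : ℝ) ^ w) * ∏ p ∈ (N₁ * N₂).primeFactors, locSq f₁ w p := by
  have hN : N₁ * N₂ ≠ 0 := mul_ne_zero (NeZero.ne N₁) (NeZero.ne N₂)
  have hw0 : w ≠ 0 := by linarith
  -- Euler products as limits of the partial products over `primesBelow n`
  have hlim : ∀ {M : ℕ} [NeZero M] {g : CuspForm (Gamma0 M) 2}, IsNewform0 g →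
      Tendsto (fun n : ℕ ↦ ∏ p ∈ Nat.primesBelow n, locSq g w p) atTop
        (𝓝 (∑' n : ℕ, ‖cuspCoeff g n‖ ^ 2 / (n : ℝ) ^ w)) := by
    intro M _ g hg
    refine EulerProduct.eulerProduct (f := fun n : ℕ ↦ ‖cuspCoeff g n‖ ^ 2 / (n : ℝ) ^ w) ?_ ?_ ?_ ?_
    · simp [show cuspCoeff g 1 = 1 from hg.2.2]
    · intro m n hmn
      have hc : cuspCoeff g (m * n) = cuspCoeff g m * cuspCoeff g n :=
        IsNewform0.coeff_mul_of_coprime_holds hg hmn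
      change ‖cuspCoeff g (m * n)‖ ^ 2 / ((m * n : ℕ) : ℝ) ^ w =
        ‖cuspCoeff g m‖ ^ 2 / (m : ℝ) ^ w * (‖cuspCoeff g n‖ ^ 2 / (n : ℝ) ^ w)
      rw [hc, norm_mul, Nat.cast_mul, Real.mul_rpow (Nat.cast_nonneg m) (Nat.cast_nonneg n)]
      ring
    · refine (summable_normSq_cuspCoeff_div_rpow g hw).congr fun n ↦ ?_
      rw [Real.norm_of_nonneg (by positivity)]
    · simp [Real.zero_rpow hw0]
  -- splitting the partial products for `n > N₁N₂`
  have hsplit : ∀ {M : ℕ} (g : CuspForm (Gamma0 M) 2) {n : ℕ}, N₁ * N₂ < n →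
      ∏ p ∈ Nat.primesBelow n, locSq g w p =
        (∏ p ∈ (N₁ * N₂).primeFactors, locSq g w p) *
          ∏ p ∈ (Nat.primesBelow n).filter (fun p ↦ ¬ p ∣ N₁ * N₂), locSq g w p := by
    intro M g n hn
    rw [← Finset.prod_filter_mul_prod_filter_not (Nat.primesBelow n) (· ∣ N₁ * N₂)]
    congr 1
    refine Finset.prod_congr ?_ fun _ _ ↦ rfl
    ext p
    simp only [Finset.mem_filter, Nat.mem_primesBelow, Nat.mem_primeFactors]
    constructor
    · rintro ⟨⟨-, hp⟩, hd⟩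
      exact ⟨hp, hd, hN⟩
    · rintro ⟨hp, hd, -⟩
      exact ⟨⟨lt_of_le_of_lt (Nat.le_of_dvd (Nat.pos_of_ne_zero hN) hd) hn, hp⟩, hd⟩
  -- the good parts agree termwise
  have hgood : ∀ n : ℕ, ∏ p ∈ (Nat.primesBelow n).filter (fun p ↦ ¬ p ∣ N₁ * N₂), locSq f₁ w p =
      ∏ p ∈ (Nat.primesBelow n).filter (fun p ↦ ¬ p ∣ N₁ * N₂), locSq f₂ w p := by
    intro n
    refine Finset.prod_congr rfl fun p hp ↦ ?_
    rw [Finset.mem_filter, Nat.mem_primesBelow] at hp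
    have hpp := hp.1.2
    have hpN := hp.2
    rw [hf₁.locSq_eq_of_not_dvd hw hpp (fun hd ↦ hpN (hd.mul_right _)),
      hf₂.locSq_eq_of_not_dvd hw hpp (fun hd ↦ hpN (hd.mul_left _)), h p hpp hpN]
  -- eventually equal sequences have equal limits
  have hev : (fun n : ℕ ↦ (∏ p ∈ Nat.primesBelow n, locSq f₂ w p) * ∏ p ∈ (N₁ * N₂).primeFactors, locSq f₁ w p)
      =ᶠ[atTop] fun n ↦ (∏ p ∈ Nat.primesBelow n, locSq f₁ w p) * ∏ p ∈ (N₁ * N₂).primeFactors, locSq f₂ w p := by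
    filter_upwards [eventually_gt_atTop (N₁ * N₂)] with n hn
    rw [hsplit f₁ hn, hsplit f₂ hn, hgood n]
    simp only [mul_comm, mul_left_comm]
  exact tendsto_nhds_unique ((hlim hf₁).mul_const _) (((hlim hf₂).mul_const _).congr' hev)

/-- **The identity on the Siegel ball.** For the newforms `f₁`, `f₂` of two elliptic curves with
`|a_p(f₁)| = |a_p(f₂)|` at the primes `p ∤ N₁N₂`, and a ball `|s − 2| < 1 + 2r` on which `Re s > 0`
and `(s−1)ζ(s) ≠ 0`:
`L_{f₁}(s) ∏_{p∣N₁N₂} E_p(f₂, s) = L_{f₂}(s) ∏_{p∣N₁N₂} E_p(f₁, s)` there (both sides are holomorphic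
and agree on `(1, 3)` by `tsum_normSq_mul_prod_eq`). [cite: HoffsteinLockhart1994, Thm. 0.1 (proof)] -/
theorem symmSqL_mul_prod_sqLocalFactor_eq {W₁ W₂ : WeierstrassCurve ℚ} [W₁.IsElliptic] [W₂.IsElliptic]
    (hf₁ : IsNewformOf W₁ f₁) (hf₂ : IsNewformOf W₂ f₂)
    (h : ∀ p : ℕ, p.Prime → ¬ p ∣ N₁ * N₂ → ‖cuspCoeff f₁ p‖ = ‖cuspCoeff f₂ p‖)
    {r : ℝ} (hr0 : 0 ≤ r) (hr : ∀ s ∈ ball (2 : ℂ) (1 + 2 * r), 0 < s.re ∧ riemannZeta₁ s ≠ 0) :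
    EqOn (fun s ↦ symmSqL N₁ f₁ s * ∏ p ∈ (N₁ * N₂).primeFactors, sqLocalFactor f₂ p s)
      (fun s ↦ symmSqL N₂ f₂ s * ∏ p ∈ (N₁ * N₂).primeFactors, sqLocalFactor f₁ p s)
      (ball (2 : ℂ) (1 + 2 * r)) := by
  set U : Set ℂ := ball (2 : ℂ) (1 + 2 * r) with hUdef
  have hU : IsOpen U := isOpen_ball
  have hUc : IsPreconnected U := (convex_ball _ _).isPreconnected
  have hprime : ∀ p ∈ (N₁ * N₂).primeFactors, p.Prime := fun p hp ↦ Nat.prime_of_mem_primeFactors hp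
  -- holomorphy of both sides
  have hdL : ∀ {M : ℕ} [NeZero M] (g : CuspForm (Gamma0 M) 2), DifferentiableOn ℂ (symmSqL M g) U :=
    fun g ↦ (differentiableOn_symmSqL g).mono fun s hs ↦ hr s hs
  have hdE : ∀ {M : ℕ} [NeZero M] {W : WeierstrassCurve ℚ} [W.IsElliptic] {g : CuspForm (Gamma0 M) 2},
      IsNewformOf W g → DifferentiableOn ℂ (fun s ↦ ∏ p ∈ (N₁ * N₂).primeFactors, sqLocalFactor g p s) U := by
    intro M _ W _ g hg
    have e : (fun s ↦ ∏ p ∈ (N₁ * N₂).primeFactors, sqLocalFactor g p s) =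
        ∏ p ∈ (N₁ * N₂).primeFactors, sqLocalFactor g p := by
      funext s; exact (Finset.prod_apply _ _ _).symm
    rw [e]
    exact DifferentiableOn.finsetProd fun p hp ↦
      (hg.differentiableOn_sqLocalFactor (hprime p hp)).mono fun s hs ↦ (hr s hs).1
  have hF : DifferentiableOn ℂ (fun s ↦ symmSqL N₁ f₁ s * ∏ p ∈ (N₁ * N₂).primeFactors, sqLocalFactor f₂ p s) U :=
    (hdL f₁).mul (hdE hf₂)
  have hG : DifferentiableOn ℂ (fun s ↦ symmSqL N₂ f₂ s * ∏ p ∈ (N₁ * N₂).primeFactors, sqLocalFactor f₁ p s) U :=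
    (hdL f₂).mul (hdE hf₁)
  have hmem : ∀ σ : ℝ, 1 < σ → σ < 3 → (σ : ℂ) ∈ U := by
    intro σ h1 h3
    rw [hUdef, mem_ball, dist_eq_norm, ← Complex.ofReal_ofNat, ← Complex.ofReal_sub, Complex.norm_real,
      Real.norm_eq_abs, abs_lt]
    constructor <;> linarith
  -- agreement at real `σ ∈ (1, 3)`
  have heq : ∀ σ : ℝ, 1 < σ → σ < 3 →
      symmSqL N₁ f₁ σ * ∏ p ∈ (N₁ * N₂).primeFactors, sqLocalFactor f₂ p σ =
        symmSqL N₂ f₂ σ * ∏ p ∈ (N₁ * N₂).primeFactors, sqLocalFactor f₁ p σ := by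
    intro σ h1 _
    have hσ : 1 < (σ : ℂ).re := by simpa using h1
    have hx : σ + 1 ≠ 0 := by linarith
    have hw : 2 < σ + 1 := by linarith
    -- the pieces as real numbers
    have hT : ∀ {M : ℕ} (g : CuspForm (Gamma0 M) 2),
        LSeries (fun n ↦ ((‖cuspCoeff g n‖ ^ 2 : ℝ) : ℂ)) ((σ : ℂ) + 1) =
          ((∑' n : ℕ, ‖cuspCoeff g n‖ ^ 2 / (n : ℝ) ^ (σ + 1) : ℝ) : ℂ) := by
      intro M g
      rw [show (σ : ℂ) + 1 = ((σ + 1 : ℝ) : ℂ) by push_cast; ring, LSeries_ofReal_apply_ofReal _ hx]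
      congr 1
      refine tsum_congr fun n ↦ ?_
      rw [Real.rpow_neg (Nat.cast_nonneg n), div_eq_mul_inv]
    have hE : ∀ {M : ℕ} (g : CuspForm (Gamma0 M) 2) {p : ℕ}, p.Prime →
        sqLocalFactor g p σ = ((locSq g (σ + 1) p : ℝ) : ℂ) := by
      intro M g p hp
      rw [sqLocalFactor, show (σ : ℂ) + 1 = ((σ + 1 : ℝ) : ℂ) by push_cast; ring, LSeries_sqCoeffAt_ofReal g hp,
        locSq_eq_tsum_mul_pow g _ hp.pos]
    have hE₁ : ∏ p ∈ (N₁ * N₂).primeFactors, sqLocalFactor f₁ p σ =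
        ((∏ p ∈ (N₁ * N₂).primeFactors, locSq f₁ (σ + 1) p : ℝ) : ℂ) := by
      rw [Complex.ofReal_prod]
      exact Finset.prod_congr rfl fun p hp ↦ hE f₁ (hprime p hp)
    have hE₂ : ∏ p ∈ (N₁ * N₂).primeFactors, sqLocalFactor f₂ p σ =
        ((∏ p ∈ (N₁ * N₂).primeFactors, locSq f₂ (σ + 1) p : ℝ) : ℂ) := by
      rw [Complex.ofReal_prod]
      exact Finset.prod_congr rfl fun p hp ↦ hE f₂ (hprime p hp)
    have key := tsum_normSq_mul_prod_eq hf₁.1 hf₂.1 h hw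
    rw [symmSqL_eq_of_one_lt_re f₁ hσ, symmSqL_eq_of_one_lt_re f₂ hσ, hT f₁, hT f₂, hE₁, hE₂]
    have hζ : riemannZeta (σ : ℂ) ≠ 0 := riemannZeta_ne_zero_of_one_le_re (by simpa using h1.le)
    field_simp
    rw [mul_assoc, mul_assoc, ← Complex.ofReal_mul, ← Complex.ofReal_mul, key]
  exact eqOn_of_differentiableOn_of_eq_on_Ioo hU hUc hF hG (by norm_num : (1 : ℝ) < 3) hmem heq

end Pair

/-! ### `TwistEquiv` and the field `equiv_case` -/

section Twist

/-- **Twist-equivalence of elliptic newforms** (the `GL₂`-side relation): `|a_p(f_i)| = |a_p(f_j)|`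
for every prime `p ∤ N_iN_j` (model: `f_j = f_i ⊗ χ` with `χ` quadratic; if `Sym² π_i ≃ Sym² π_j`
then `a_p(f_i)² = a_p(f_j)²` at the good primes, so the relation contains the polar locus of the
pair functions `L(s, Sym² f_i × Sym² f_j)` of two non-CM forms).
[cite: HoffsteinLockhart1994, Thm. 0.1 (proof, the twist-equivalent case)] -/
def TwistEquiv (i j : EllipticNewformIndex) : Prop :=
  ∀ p : ℕ, p.Prime → ¬ p ∣ i.N * j.N → ‖cuspCoeff i.f p‖ = ‖cuspCoeff j.f p‖

/-- `TwistEquiv` is reflexive. [folklore] -/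
theorem twistEquiv_refl (i : EllipticNewformIndex) : TwistEquiv i i := fun _ _ _ ↦ rfl

/-- `TwistEquiv` is symmetric. [folklore] -/
theorem TwistEquiv.symm {i j : EllipticNewformIndex} (h : TwistEquiv i j) : TwistEquiv j i :=
  fun p hp hpN ↦ (h p hp (by rwa [mul_comm])).symm

/-- **The field `equiv_case` for `Equiv = TwistEquiv`**: for every `δ > 0` there is `D(δ) > 0` with
`D (N_iN_j)^{−δ} Re L_{f_j}(1) ≤ Re L_{f_i}(1)` whenever `TwistEquiv i j`. Proof: at `s = 1` the identity
`symmSqL_mul_prod_sqLocalFactor_eq` reads `L_{f_i}(1) ρ_j = L_{f_j}(1) ρ_i` with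
`ρ = ∏_{p∣N_iN_j} E_p(·, 1) ∈ [1, ∏_{p∣N_iN_j}(1 + 30/p)]`, and `∏_{p∣M}(1 + 30/p) ≤ K(δ) M^δ`.
[cite: HoffsteinLockhart1994, Thm. 0.1 (proof, the twist-equivalent case)] -/
theorem twistEquiv_equiv_case {δ : ℝ} (hδ : 0 < δ) :
    ∃ D : ℝ, 0 < D ∧ ∀ i j : EllipticNewformIndex, TwistEquiv i j →
      D * ((i.N : ℝ) * j.N) ^ (-δ) * (symmSqL j.N j.f 1).re ≤ (symmSqL i.N i.f 1).re := by
  obtain ⟨K, hK, hKle⟩ := exists_prod_primeFactors_one_add_div_le (C := 30) (by norm_num) hδ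
  obtain ⟨r, hr0, -, hr⟩ := exists_siegel_radius
  refine ⟨K⁻¹, by positivity, fun i j hij ↦ ?_⟩
  have hN : i.N * j.N ≠ 0 := mul_ne_zero (NeZero.ne i.N) (NeZero.ne j.N)
  have hiN := NeZero.pos i.N
  have hjN := NeZero.pos j.N
  have hNpos : (0 : ℝ) < (i.N : ℝ) * j.N := by positivity
  have hprime : ∀ p ∈ (i.N * j.N).primeFactors, p.Prime := fun p hp ↦ Nat.prime_of_mem_primeFactors hp
  -- the identity at `s = 1`
  have h1mem : (1 : ℂ) ∈ ball (2 : ℂ) (1 + 2 * r) := by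
    rw [mem_ball, dist_eq_norm, show (1 : ℂ) - 2 = -1 by norm_num, norm_neg, norm_one]
    linarith
  have hEq := symmSqL_mul_prod_sqLocalFactor_eq i.isNewformOf j.isNewformOf hij hr0.le hr h1mem
  simp only [] at hEq
  -- real values of the local factors at `1`
  set E : EllipticNewformIndex → ℕ → ℝ := fun k p ↦
    ∑' e : ℕ, ‖cuspCoeff k.f (p ^ e)‖ ^ 2 * ((p : ℝ) ^ (-(1 + 1 : ℝ))) ^ e with hEdef
  have hEval : ∀ (k : EllipticNewformIndex) {p : ℕ}, p.Prime →
      sqLocalFactor k.f p 1 = ((E k p : ℝ) : ℂ) ∧ 1 ≤ E k p := by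
    intro k p hp
    have h := k.isNewformOf.sqLocalFactor_ofReal hp (σ := 1) one_pos
    rw [Complex.ofReal_one] at h
    exact h
  set ρ : EllipticNewformIndex → ℝ := fun k ↦ ∏ p ∈ (i.N * j.N).primeFactors, E k p with hρdef
  have hρval : ∀ k : EllipticNewformIndex,
      ∏ p ∈ (i.N * j.N).primeFactors, sqLocalFactor k.f p 1 = ((ρ k : ℝ) : ℂ) := by
    intro k
    rw [hρdef, Complex.ofReal_prod]
    exact Finset.prod_congr rfl fun p hp ↦ (hEval k (hprime p hp)).1
  have hρ1 : ∀ k : EllipticNewformIndex, 1 ≤ ρ k := fun k ↦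
    Finset.one_le_prod fun p hp ↦ (hEval k (hprime p hp)).2
  have hρle : ρ j ≤ K * ((i.N : ℝ) * j.N) ^ δ := by
    have h1 : ρ j ≤ ∏ p ∈ (i.N * j.N).primeFactors, (1 + 30 / (p : ℝ)) := by
      refine Finset.prod_le_prod (fun p hp ↦ zero_le_one.trans (hEval j (hprime p hp)).2) fun p hp ↦ ?_
      exact j.isNewformOf.sqLocalFactor_one_le (hprime p hp)
    have h2 := hKle (i.N * j.N) hN
    push_cast at h2
    exact h1.trans h2
  -- the values `L(1)` are positive reals
  have hℓi := symmSqL_one_re_pos i.f i.isNewformOf.peterssonProduct_re_pos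
  have hℓj := symmSqL_one_re_pos j.f j.isNewformOf.peterssonProduct_re_pos
  rw [hρval i, hρval j] at hEq
  have hre : (symmSqL i.N i.f 1).re * ρ j = (symmSqL j.N j.f 1).re * ρ i := by
    have := congrArg Complex.re hEq
    rwa [Complex.re_mul_ofReal, Complex.re_mul_ofReal] at this
  have hρj0 : 0 < ρ j := one_pos.trans_le (hρ1 j)
  have hKM : 0 < K * ((i.N : ℝ) * j.N) ^ δ := by positivity
  -- `ℓ_i = ℓ_j ρ_i / ρ_j ≥ ℓ_j / ρ_j ≥ ℓ_j / (K M^δ)`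
  have step1 : (symmSqL j.N j.f 1).re ≤ (symmSqL i.N i.f 1).re * ρ j := by
    rw [hre]
    exact le_mul_of_one_le_right hℓj.1.le (hρ1 i)
  have step2 : (symmSqL j.N j.f 1).re / (K * ((i.N : ℝ) * j.N) ^ δ) ≤ (symmSqL i.N i.f 1).re := by
    rw [div_le_iff₀ hKM]
    calc (symmSqL j.N j.f 1).re ≤ (symmSqL i.N i.f 1).re * ρ j := step1
      _ ≤ (symmSqL i.N i.f 1).re * (K * ((i.N : ℝ) * j.N) ^ δ) := by gcongr; exact hℓi.1.le
  calc K⁻¹ * ((i.N : ℝ) * j.N) ^ (-δ) * (symmSqL j.N j.f 1).re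
      = (symmSqL j.N j.f 1).re / (K * ((i.N : ℝ) * j.N) ^ δ) := by
        rw [Real.rpow_neg hNpos.le]
        field_simp
    _ ≤ (symmSqL i.N i.f 1).re := step2

end Twist

end Literature.NumberTheory.EllipticCurves.ModularForms

end
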